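import Summits.ValiantsHypothesis.ValiantsHypothesis.Theorems.MonotoneRestorationOrbitRestorationQPMatrixAffineTools
import HarnessLib

/-!
# Matrix-symmetric affine products: the (TOP#) count at the transposed pair (ORBIT currency, ΠΣ sub-rung)

Route MonotoneRestoration, crux `OrbitRestorationQP` (stmt-ValiantsHypothesis-18293), line `depth-three-rung`,
stub A₁ `stub_piSigmaValue`, namespace `Summit.ValiantsHypothesis.ValiantsHypothesis.Theorems.MatrixAffine`.

Case `K = {x, y}` of the parity verification of (TOP#) for rule M2′ (evidence `A1-M2PRIME-PROOF.md`, §3 (i),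
(ii), (iv)): with the key `kf` determined by the parities of the two fibre sign counts `rc`, `cc`, the number of
row-negated factors keyed `{x,y}` with `(x y)`-stable column support plus the number of column-negated factors keyed
`{x,y}` with stable row support is EVEN.  Ingredients: evenness of the global row/column sign counts
(`ActionSignCount.even_card_filter_vact_neg`), the pairing of moved supports along the opposite transposition
(`KeyCounts.card_filter_eq_of_transport`), and a fibrewise comparison of the two fibre shapes through
`({x,y}, D)` and `(D, {x,y})` (transport `hswap_counts`).  All hypotheses are discharged in
`MatrixAffine.qpOrbitRestorable_of_matrixSymmetric`.  Everything is proved. [folklore]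
-/

noncomputable section

open scoped Classical Pointwise

-- `Summit.ValiantsHypothesis.ValiantsHypothesis.…` is the tree's single-conjunct layout (Sub = Summit).
set_option linter.dupNamespace false

namespace Summit.ValiantsHypothesis.ValiantsHypothesis.Theorems

namespace MatrixAffine

open Equiv Finset ProductAction Literature.Computability.AlgebraicComplexity OrbitRestorationQPDepthThreeRung

variable {n : ℕ}

/-- **(TOP#) at the transposed pair.**  See the module docstring. [folklore] -/
theorem top_counts_even_pair
    (R C : MvPolynomial (Fin n × Fin n) ℂ → Finset (Fin n))
    {L : Multiset (MvPolynomial (Fin n × Fin n) ℂ)} {a : ℂ}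
    (hL1 : ∀ ℓ ∈ L, ℓ.totalDegree = 1) (hf0 : MvPolynomial.C a * L.prod ≠ 0)
    (hrow : ∀ σ : Perm (Fin n), vact (K := ℂ) rowHom σ (MvPolynomial.C a * L.prod) = MvPolynomial.C a * L.prod)
    (hcol : ∀ τ : Perm (Fin n), vact (K := ℂ) colHom τ (MvPolynomial.C a * L.prod) = MvPolynomial.C a * L.prod)
    (R1 : ∀ (q : MvPolynomial (Fin n × Fin n) ℂ) (u : ℂ), u ≠ 0 → R (MvPolynomial.C u * q) = R q)
    (C1 : ∀ (q : MvPolynomial (Fin n × Fin n) ℂ) (u : ℂ), u ≠ 0 → C (MvPolynomial.C u * q) = C q)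
    (R2 : ∀ (q : MvPolynomial (Fin n × Fin n) ℂ) (σ : Perm (Fin n)), R (vact (K := ℂ) rowHom σ q) = σ • R q)
    (C2 : ∀ (q : MvPolynomial (Fin n × Fin n) ℂ) (τ : Perm (Fin n)), C (vact (K := ℂ) colHom τ q) = τ • C q)
    {x y : Fin n} (hxy : x ≠ y)
    (hα_row : ∀ ℓ ∈ L, vact (K := ℂ) rowHom (swap x y) ℓ = -ℓ → R ℓ = {x, y})
    (hα_col : ∀ ℓ ∈ L, vact (K := ℂ) colHom (swap x y) ℓ = -ℓ → C ℓ = {x, y})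
    (rc cc : Finset (Fin n) → Finset (Fin n) → ℕ)
    (hrc : ∀ A B : Finset (Fin n), rc A B = Multiset.card (L.filter fun ℓ =>
      R ℓ = A ∧ C ℓ = B ∧ (A.card = 2 ∧ ∀ x ∈ A, ∀ y ∈ A, x ≠ y → vact (K := ℂ) rowHom (swap x y) ℓ = -ℓ)))
    (hcc : ∀ A B : Finset (Fin n), cc A B = Multiset.card (L.filter fun ℓ =>
      R ℓ = A ∧ C ℓ = B ∧ (B.card = 2 ∧ ∀ x ∈ B, ∀ y ∈ B, x ≠ y → vact (K := ℂ) colHom (swap x y) ℓ = -ℓ)))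
    (hswap_counts : ∀ A B : Finset (Fin n), A.card = 2 → B.card = 2 → rc B A = rc A B ∧ cc B A = cc A B)
    (hrc_zero : ∀ A B : Finset (Fin n), A.card ≠ 2 → rc A B = 0)
    (hcc_zero : ∀ A B : Finset (Fin n), B.card ≠ 2 → cc A B = 0)
    (kf : Finset (Fin n) → Finset (Fin n) → Finset (Fin n))
    (hkf_cases : ∀ A B : Finset (Fin n), (kf A B = A ∧ Odd (rc A B) ∧ ¬Odd (cc A B)) ∨
      (kf A B = B ∧ Odd (cc A B) ∧ ¬Odd (rc A B)) ∨ (kf A B = A ∪ B ∧ (Odd (rc A B) ↔ Odd (cc A B)))) :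
    Even (Multiset.card (L.filter fun ℓ => vact (K := ℂ) rowHom (swap x y) ℓ = -ℓ ∧
        (swap x y • C ℓ = C ℓ ∧ kf {x, y} (C ℓ) = {x, y})) +
      Multiset.card (L.filter fun ℓ => vact (K := ℂ) colHom (swap x y) ℓ = -ℓ ∧
        (swap x y • R ℓ = R ℓ ∧ kf (R ℓ) {x, y} = {x, y}))) := by
  have hsK₀ : swap x y • ({x, y} : Finset (Fin n)) = {x, y} :=
    SignFree.swap_smul_finset_eq (by simp) (by simp)
  have hinj : ∀ (X Y : Finset (Fin n)), swap x y • X = swap x y • Y → X = Y :=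
    fun X Y h => MulAction.injective (swap x y) h
  let Qρ : MvPolynomial (Fin n × Fin n) ℂ → Prop := fun ℓ => swap x y • C ℓ = C ℓ ∧ kf {x, y} (C ℓ) = {x, y}
  let Qκ : MvPolynomial (Fin n × Fin n) ℂ → Prop := fun ℓ => swap x y • R ℓ = R ℓ ∧ kf (R ℓ) {x, y} = {x, y}
  show Even (Multiset.card (L.filter fun ℓ => vact (K := ℂ) rowHom (swap x y) ℓ = -ℓ ∧ Qρ ℓ) +
    Multiset.card (L.filter fun ℓ => vact (K := ℂ) colHom (swap x y) ℓ = -ℓ ∧ Qκ ℓ))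
  -- fibres: the label and the two fibre shapes
  let g : MvPolynomial (Fin n × Fin n) ℂ → Finset (Fin n) := fun ℓ => if R ℓ = {x, y} then C ℓ else R ℓ
  let Fρ : Finset (Fin n) → Multiset (MvPolynomial (Fin n × Fin n) ℂ) := fun D => L.filter fun ℓ =>
    R ℓ = {x, y} ∧ C ℓ = D ∧ (({x, y} : Finset (Fin n)).card = 2 ∧
      ∀ x' ∈ ({x, y} : Finset (Fin n)), ∀ y' ∈ ({x, y} : Finset (Fin n)), x' ≠ y' →
        vact (K := ℂ) rowHom (swap x' y') ℓ = -ℓ)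
  let Fκ : Finset (Fin n) → Multiset (MvPolynomial (Fin n × Fin n) ℂ) := fun D => L.filter fun ℓ =>
    R ℓ = D ∧ C ℓ = {x, y} ∧ (({x, y} : Finset (Fin n)).card = 2 ∧
      ∀ x' ∈ ({x, y} : Finset (Fin n)), ∀ y' ∈ ({x, y} : Finset (Fin n)), x' ≠ y' →
        vact (K := ℂ) colHom (swap x' y') ℓ = -ℓ)
  have hFρ : ∀ D, Multiset.card (Fρ D) = rc {x, y} D := fun D => (hrc {x, y} D).symm
  have hFκ : ∀ D, Multiset.card (Fκ D) = cc D {x, y} := fun D => (hcc D {x, y}).symm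
  have hfibρ : ∀ (Q : MvPolynomial (Fin n × Fin n) ℂ → Prop) [DecidablePred Q] (D : Finset (Fin n)),
      (∀ ℓ ∈ L, ∀ ℓ' ∈ L, C ℓ = C ℓ' → (Q ℓ ↔ Q ℓ')) →
      ((∃ ℓ₁ ∈ L, C ℓ₁ = D ∧ Q ℓ₁) →
        ((L.filter fun ℓ => vact (K := ℂ) rowHom (swap x y) ℓ = -ℓ ∧ Q ℓ).filter fun ℓ => g ℓ = D) = Fρ D) ∧
      ((¬∃ ℓ₁ ∈ L, C ℓ₁ = D ∧ Q ℓ₁) →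
        ((L.filter fun ℓ => vact (K := ℂ) rowHom (swap x y) ℓ = -ℓ ∧ Q ℓ).filter fun ℓ => g ℓ = D) = 0) := by
    intro Q _ D hQ
    constructor
    · rintro ⟨ℓ₁, hℓ₁, hC₁, hQ₁⟩
      simp only [Fρ, Multiset.filter_filter]
      refine Multiset.filter_congr fun ℓ hℓ => ?_
      rw [pair_rowNeg_iff hxy]
      constructor
      · rintro ⟨hg, hneg, -⟩
        have hR := hα_row ℓ hℓ hneg
        simp only [g, hR, if_true] at hg
        exact ⟨hR, hg, hneg⟩
      · rintro ⟨hR, hC, hneg⟩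
        refine ⟨by simp only [g, hR, if_true, hC], hneg, (hQ ℓ hℓ ℓ₁ hℓ₁ (hC.trans hC₁.symm)).2 hQ₁⟩
    · intro hno
      rw [Multiset.filter_eq_nil]
      intro ℓ hℓ hg
      obtain ⟨hℓL, hneg, hQℓ⟩ := Multiset.mem_filter.1 hℓ
      have hR := hα_row ℓ hℓL hneg
      simp only [g, hR, if_true] at hg
      exact hno ⟨ℓ, hℓL, hg, hQℓ⟩
  have hfibκ : ∀ (Q : MvPolynomial (Fin n × Fin n) ℂ → Prop) [DecidablePred Q] (D : Finset (Fin n)),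
      (∀ ℓ ∈ L, ∀ ℓ' ∈ L, R ℓ = R ℓ' → (Q ℓ ↔ Q ℓ')) →
      ((∃ ℓ₁ ∈ L, R ℓ₁ = D ∧ Q ℓ₁) →
        ((L.filter fun ℓ => vact (K := ℂ) colHom (swap x y) ℓ = -ℓ ∧ Q ℓ).filter fun ℓ => g ℓ = D) = Fκ D) ∧
      ((¬∃ ℓ₁ ∈ L, R ℓ₁ = D ∧ Q ℓ₁) →
        ((L.filter fun ℓ => vact (K := ℂ) colHom (swap x y) ℓ = -ℓ ∧ Q ℓ).filter fun ℓ => g ℓ = D) = 0) := by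
    intro Q _ D hQ
    have hg_of : ∀ ℓ ∈ L, vact (K := ℂ) colHom (swap x y) ℓ = -ℓ → g ℓ = R ℓ := by
      intro ℓ hℓ hneg
      have hC := hα_col ℓ hℓ hneg
      by_cases hR : R ℓ = {x, y}
      · simp only [g, hR, if_true, hC]
      · simp only [g, hR, if_false]
    constructor
    · rintro ⟨ℓ₁, hℓ₁, hR₁, hQ₁⟩
      simp only [Fκ, Multiset.filter_filter]
      refine Multiset.filter_congr fun ℓ hℓ => ?_
      rw [pair_colNeg_iff hxy]
      constructor
      · rintro ⟨hg, hneg, -⟩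
        rw [hg_of ℓ hℓ hneg] at hg
        exact ⟨hg, hα_col ℓ hℓ hneg, hneg⟩
      · rintro ⟨hR, hC, hneg⟩
        refine ⟨by rw [hg_of ℓ hℓ hneg, hR], hneg, (hQ ℓ hℓ ℓ₁ hℓ₁ (hR.trans hR₁.symm)).2 hQ₁⟩
    · intro hno
      rw [Multiset.filter_eq_nil]
      intro ℓ hℓ hg
      obtain ⟨hℓL, hneg, hQℓ⟩ := Multiset.mem_filter.1 hℓ
      rw [hg_of ℓ hℓL hneg] at hg
      exact hno ⟨ℓ, hℓL, hg, hQℓ⟩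
  -- parity of a fibre sum from the two possible shapes
  have hfibre_even : ∀ (Q₁ Q₂ : MvPolynomial (Fin n × Fin n) ℂ → Prop) [DecidablePred Q₁] [DecidablePred Q₂]
      (D : Finset (Fin n)),
      (∀ ℓ ∈ L, ∀ ℓ' ∈ L, C ℓ = C ℓ' → (Q₁ ℓ ↔ Q₁ ℓ')) →
      (∀ ℓ ∈ L, ∀ ℓ' ∈ L, R ℓ = R ℓ' → (Q₂ ℓ ↔ Q₂ ℓ')) →
      ((∃ ℓ₁ ∈ L, C ℓ₁ = D ∧ Q₁ ℓ₁) → (∃ ℓ₂ ∈ L, R ℓ₂ = D ∧ Q₂ ℓ₂) → Even (rc {x, y} D + cc D {x, y})) →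
      ((∃ ℓ₁ ∈ L, C ℓ₁ = D ∧ Q₁ ℓ₁) → (¬∃ ℓ₂ ∈ L, R ℓ₂ = D ∧ Q₂ ℓ₂) → Even (rc {x, y} D)) →
      ((¬∃ ℓ₁ ∈ L, C ℓ₁ = D ∧ Q₁ ℓ₁) → (∃ ℓ₂ ∈ L, R ℓ₂ = D ∧ Q₂ ℓ₂) → Even (cc D {x, y})) →
      Even (Multiset.card (((L.filter fun ℓ => vact (K := ℂ) rowHom (swap x y) ℓ = -ℓ ∧ Q₁ ℓ) +
          (L.filter fun ℓ => vact (K := ℂ) colHom (swap x y) ℓ = -ℓ ∧ Q₂ ℓ)).filter fun ℓ => g ℓ = D)) := by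
    intro Q₁ Q₂ _ _ D hQ₁ hQ₂ hboth hleft hright
    rw [Multiset.filter_add, Multiset.card_add]
    by_cases h1 : ∃ ℓ₁ ∈ L, C ℓ₁ = D ∧ Q₁ ℓ₁ <;> by_cases h2 : ∃ ℓ₂ ∈ L, R ℓ₂ = D ∧ Q₂ ℓ₂
    · rw [(hfibρ Q₁ D hQ₁).1 h1, (hfibκ Q₂ D hQ₂).1 h2, hFρ, hFκ]; exact hboth h1 h2
    · rw [(hfibρ Q₁ D hQ₁).1 h1, (hfibκ Q₂ D hQ₂).2 h2, hFρ, Multiset.card_zero, add_zero]; exact hleft h1 h2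
    · rw [(hfibρ Q₁ D hQ₁).2 h1, (hfibκ Q₂ D hQ₂).1 h2, hFκ, Multiset.card_zero, zero_add]; exact hright h1 h2
    · rw [(hfibρ Q₁ D hQ₁).2 h1, (hfibκ Q₂ D hQ₂).2 h2]; exact ⟨0, rfl⟩
  have hQρC : ∀ ℓ ∈ L, ∀ ℓ' ∈ L, C ℓ = C ℓ' → (Qρ ℓ ↔ Qρ ℓ') := fun ℓ _ ℓ' _ h => by simp only [Qρ, h]
  have hQκR : ∀ ℓ ∈ L, ∀ ℓ' ∈ L, R ℓ = R ℓ' → (Qκ ℓ ↔ Qκ ℓ') := fun ℓ _ ℓ' _ h => by simp only [Qκ, h]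
  have hK₀2 : (({x, y} : Finset (Fin n))).card = 2 := card_pair hxy
  -- parity helpers
  have hev_of_iff : ∀ {r c : ℕ}, (Odd r ↔ Odd c) → Even (r + c) := by
    intro r c h
    rw [Nat.even_add]
    constructor
    · intro hr; by_contra hc; exact (Nat.not_even_iff_odd.2 (h.2 (Nat.not_even_iff_odd.1 hc))) hr
    · intro hc; by_contra hr; exact (Nat.not_even_iff_odd.2 (h.1 (Nat.not_even_iff_odd.1 hr))) hc
  have hEρ := ActionSignCount.even_card_filter_vact_neg rowHom hL1 hf0 hrow (swap_mul_self x y)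
  have hEκ := ActionSignCount.even_card_filter_vact_neg colHom hL1 hf0 hcol (swap_mul_self x y)
  -- split the global counts by `Qρ` / `Qκ`
  have hsplitρ := Multiset.filter_add_not Qρ (L.filter fun ℓ => vact (K := ℂ) rowHom (swap x y) ℓ = -ℓ)
  have hsplitκ := Multiset.filter_add_not Qκ (L.filter fun ℓ => vact (K := ℂ) colHom (swap x y) ℓ = -ℓ)
  rw [← hsplitρ, Multiset.card_add, Multiset.filter_filter, Multiset.filter_filter] at hEρ
  rw [← hsplitκ, Multiset.card_add, Multiset.filter_filter, Multiset.filter_filter] at hEκ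
  have eρ : (L.filter fun ℓ => Qρ ℓ ∧ vact (K := ℂ) rowHom (swap x y) ℓ = -ℓ) =
      L.filter fun ℓ => vact (K := ℂ) rowHom (swap x y) ℓ = -ℓ ∧ Qρ ℓ :=
    Multiset.filter_congr fun ℓ _ => and_comm
  have eκ : (L.filter fun ℓ => Qκ ℓ ∧ vact (K := ℂ) colHom (swap x y) ℓ = -ℓ) =
      L.filter fun ℓ => vact (K := ℂ) colHom (swap x y) ℓ = -ℓ ∧ Qκ ℓ :=
    Multiset.filter_congr fun ℓ _ => and_comm
  rw [eρ] at hEρ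
  rw [eκ] at hEκ
  rw [Nat.even_add, Nat.even_add.1 hEρ, Nat.even_add.1 hEκ, ← Nat.even_add]
  -- now: members NOT counted; split by moved / fixed supports
  have hsplitρ' := Multiset.filter_add_not (fun ℓ => swap x y • C ℓ = C ℓ)
    (L.filter fun ℓ => ¬Qρ ℓ ∧ vact (K := ℂ) rowHom (swap x y) ℓ = -ℓ)
  have hsplitκ' := Multiset.filter_add_not (fun ℓ => swap x y • R ℓ = R ℓ)
    (L.filter fun ℓ => ¬Qκ ℓ ∧ vact (K := ℂ) colHom (swap x y) ℓ = -ℓ)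
  rw [← hsplitρ', ← hsplitκ', Multiset.card_add, Multiset.card_add, Multiset.filter_filter,
    Multiset.filter_filter, Multiset.filter_filter, Multiset.filter_filter]
  -- the moved parts are even (pairing along the column / row transposition)
  have hmovedρ : Even (Multiset.card (L.filter fun ℓ =>
      ¬(swap x y • C ℓ = C ℓ) ∧ ¬Qρ ℓ ∧ vact (K := ℂ) rowHom (swap x y) ℓ = -ℓ)) := by
    have hsplit := Multiset.filter_add_not (fun ℓ => x ∈ C ℓ) (L.filter fun ℓ =>
      ¬(swap x y • C ℓ = C ℓ) ∧ ¬Qρ ℓ ∧ vact (K := ℂ) rowHom (swap x y) ℓ = -ℓ)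
    rw [← hsplit, Multiset.card_add, Multiset.filter_filter, Multiset.filter_filter]
    have hpair : Multiset.card (L.filter fun ℓ => ¬x ∈ C ℓ ∧ ¬(swap x y • C ℓ = C ℓ) ∧ ¬Qρ ℓ ∧
          vact (K := ℂ) rowHom (swap x y) ℓ = -ℓ) =
        Multiset.card (L.filter fun ℓ => x ∈ C ℓ ∧ ¬(swap x y • C ℓ = C ℓ) ∧ ¬Qρ ℓ ∧
          vact (K := ℂ) rowHom (swap x y) ℓ = -ℓ) := by
      refine KeyCounts.card_filter_eq_of_transport (vact (K := ℂ) colHom (swap x y))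
        (ActionSignCount.map_mk_map_vact_eq colHom hL1 hf0 hcol (swap x y)) _ _ (fun p q hpq => ?_)
        (fun ℓ => ?_)
      · obtain ⟨c, hc0, rfl⟩ := SupportBlocks.exists_C_of_associated hpq
        simp only [Qρ, C1 p c hc0, KeyCounts.neg_iff_of_C_mul _ hc0]
      · simp only [Qρ, C2, KeyCounts.rowNeg_iff_of_col]
        have hmem : x ∈ swap x y • C ℓ ↔ y ∈ C ℓ := by
          rw [← Finset.inv_smul_mem_iff, swap_inv, Perm.smul_def, swap_apply_left]
        constructor
        · rintro ⟨hxnot, hmv, -, hneg⟩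
          have hmv' : ¬swap x y • C ℓ = C ℓ := fun h => hmv (by rw [h, h])
          have hy' : y ∉ C ℓ := fun hy' => hxnot (hmem.2 hy')
          have hx' : x ∈ C ℓ := by
            by_contra hx'
            exact hmv' ((swap_smul_eq_iff _).2 ⟨fun h => absurd h hx', fun h => absurd h hy'⟩)
          exact ⟨hx', hmv', fun h => hmv' h.1, hneg⟩
        · rintro ⟨hx', hmv, -, hneg⟩
          have hy' : y ∉ C ℓ := fun hy' => hmv ((swap_smul_eq_iff _).2 ⟨fun _ => hy', fun _ => hx'⟩)
          have hmv' : ¬swap x y • swap x y • C ℓ = swap x y • C ℓ := fun h => hmv (hinj _ _ h)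
          exact ⟨fun h => hy' (hmem.1 h), hmv', fun h => hmv' h.1, hneg⟩
    rw [hpair, ← two_mul]; exact even_two_mul _
  have hmovedκ : Even (Multiset.card (L.filter fun ℓ =>
      ¬(swap x y • R ℓ = R ℓ) ∧ ¬Qκ ℓ ∧ vact (K := ℂ) colHom (swap x y) ℓ = -ℓ)) := by
    have hsplit := Multiset.filter_add_not (fun ℓ => x ∈ R ℓ) (L.filter fun ℓ =>
      ¬(swap x y • R ℓ = R ℓ) ∧ ¬Qκ ℓ ∧ vact (K := ℂ) colHom (swap x y) ℓ = -ℓ)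
    rw [← hsplit, Multiset.card_add, Multiset.filter_filter, Multiset.filter_filter]
    have hpair : Multiset.card (L.filter fun ℓ => ¬x ∈ R ℓ ∧ ¬(swap x y • R ℓ = R ℓ) ∧ ¬Qκ ℓ ∧
          vact (K := ℂ) colHom (swap x y) ℓ = -ℓ) =
        Multiset.card (L.filter fun ℓ => x ∈ R ℓ ∧ ¬(swap x y • R ℓ = R ℓ) ∧ ¬Qκ ℓ ∧
          vact (K := ℂ) colHom (swap x y) ℓ = -ℓ) := by
      refine KeyCounts.card_filter_eq_of_transport (vact (K := ℂ) rowHom (swap x y))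
        (ActionSignCount.map_mk_map_vact_eq rowHom hL1 hf0 hrow (swap x y)) _ _ (fun p q hpq => ?_)
        (fun ℓ => ?_)
      · obtain ⟨c, hc0, rfl⟩ := SupportBlocks.exists_C_of_associated hpq
        simp only [Qκ, R1 p c hc0, KeyCounts.neg_iff_of_C_mul _ hc0]
      · simp only [Qκ, R2, KeyCounts.colNeg_iff_of_row]
        have hmem : x ∈ swap x y • R ℓ ↔ y ∈ R ℓ := by
          rw [← Finset.inv_smul_mem_iff, swap_inv, Perm.smul_def, swap_apply_left]
        constructor
        · rintro ⟨hxnot, hmv, -, hneg⟩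
          have hmv' : ¬swap x y • R ℓ = R ℓ := fun h => hmv (by rw [h, h])
          have hy' : y ∉ R ℓ := fun hy' => hxnot (hmem.2 hy')
          have hx' : x ∈ R ℓ := by
            by_contra hx'
            exact hmv' ((swap_smul_eq_iff _).2 ⟨fun h => absurd h hx', fun h => absurd h hy'⟩)
          exact ⟨hx', hmv', fun h => hmv' h.1, hneg⟩
        · rintro ⟨hx', hmv, -, hneg⟩
          have hy' : y ∉ R ℓ := fun hy' => hmv ((swap_smul_eq_iff _).2 ⟨fun _ => hy', fun _ => hx'⟩)
          have hmv' : ¬swap x y • swap x y • R ℓ = swap x y • R ℓ := fun h => hmv (hinj _ _ h)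
          exact ⟨fun h => hy' (hmem.1 h), hmv', fun h => hmv' h.1, hneg⟩
    rw [hpair, ← two_mul]; exact even_two_mul _
  rw [add_add_add_comm]
  refine Even.add ?_ (hmovedρ.add hmovedκ)
  -- the fixed parts: fibrewise
  have eρ' : (L.filter fun ℓ => swap x y • C ℓ = C ℓ ∧ ¬Qρ ℓ ∧ vact (K := ℂ) rowHom (swap x y) ℓ = -ℓ) =
      L.filter fun ℓ => vact (K := ℂ) rowHom (swap x y) ℓ = -ℓ ∧
        (swap x y • C ℓ = C ℓ ∧ kf {x, y} (C ℓ) ≠ {x, y}) := by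
    refine Multiset.filter_congr fun ℓ _ => ?_
    simp only [Qρ, not_and]
    constructor
    · rintro ⟨hC, hq, hneg⟩; exact ⟨hneg, hC, hq hC⟩
    · rintro ⟨hneg, hC, hq⟩; exact ⟨hC, fun _ => hq, hneg⟩
  have eκ' : (L.filter fun ℓ => swap x y • R ℓ = R ℓ ∧ ¬Qκ ℓ ∧ vact (K := ℂ) colHom (swap x y) ℓ = -ℓ) =
      L.filter fun ℓ => vact (K := ℂ) colHom (swap x y) ℓ = -ℓ ∧
        (swap x y • R ℓ = R ℓ ∧ kf (R ℓ) {x, y} ≠ {x, y}) := by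
    refine Multiset.filter_congr fun ℓ _ => ?_
    simp only [Qκ, not_and]
    constructor
    · rintro ⟨hR, hq, hneg⟩; exact ⟨hneg, hR, hq hR⟩
    · rintro ⟨hneg, hR, hq⟩; exact ⟨hR, fun _ => hq, hneg⟩
  rw [eρ', eκ', ← Multiset.card_add]
  refine even_card_of_fibres g _ fun D => ?_
  -- members of the fibres of the two shapes
  have hmemρ : ∀ D', 0 < rc {x, y} D' → ∃ ℓ ∈ L, R ℓ = {x, y} ∧ C ℓ = D' := by
    intro D' hpos
    rw [hrc] at hpos
    obtain ⟨ℓ, hℓ⟩ := Multiset.card_pos_iff_exists_mem.1 hpos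
    obtain ⟨hℓL, hR, hC, -⟩ := Multiset.mem_filter.1 hℓ
    exact ⟨ℓ, hℓL, hR, hC⟩
  have hmemκ : ∀ D', 0 < cc D' {x, y} → ∃ ℓ ∈ L, R ℓ = D' ∧ C ℓ = {x, y} := by
    intro D' hpos
    rw [hcc] at hpos
    obtain ⟨ℓ, hℓ⟩ := Multiset.card_pos_iff_exists_mem.1 hpos
    obtain ⟨hℓL, hR, hC, -⟩ := Multiset.mem_filter.1 hℓ
    exact ⟨ℓ, hℓL, hR, hC⟩
  refine hfibre_even (fun ℓ => swap x y • C ℓ = C ℓ ∧ kf {x, y} (C ℓ) ≠ {x, y})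
    (fun ℓ => swap x y • R ℓ = R ℓ ∧ kf (R ℓ) {x, y} ≠ {x, y}) D
    (fun ℓ _ ℓ' _ h => by simp only [h]) (fun ℓ _ ℓ' _ h => by simp only [h]) ?_ ?_ ?_
  · rintro ⟨ℓ₁, -, hC₁, hfx₁, hk₁⟩ ⟨ℓ₂, -, hR₂, hfx₂, hk₂⟩
    rw [hC₁] at hk₁ hfx₁
    rw [hR₂] at hk₂ hfx₂
    by_cases hD : D.card = 2
    · obtain ⟨hr, hc⟩ := hswap_counts {x, y} D hK₀2 hD
      rw [hc]
      rcases hkf_cases {x, y} D with ⟨hk, -, -⟩ | ⟨-, hoc, her⟩ | ⟨-, hiff⟩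
      · exact absurd hk hk₁
      · rcases hkf_cases D {x, y} with ⟨-, hor', -⟩ | ⟨hk', -, -⟩ | ⟨-, hiff'⟩
        · rw [hr] at hor'; exact absurd hor' her
        · exact absurd hk' hk₂
        · rw [hr, hc] at hiff'; exact absurd (hiff'.2 hoc) her
      · exact hev_of_iff hiff
    · have hc0 : cc {x, y} D = 0 := hcc_zero _ _ hD
      have hr0 : rc D {x, y} = 0 := hrc_zero _ _ hD
      have hevr : Even (rc {x, y} D) := by
        rcases hkf_cases {x, y} D with ⟨hk, -, -⟩ | ⟨-, hoc, -⟩ | ⟨-, hiff⟩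
        · exact absurd hk hk₁
        · rw [hc0] at hoc; exact absurd hoc (by decide)
        · rw [hc0] at hiff; exact Nat.not_odd_iff_even.1 fun h => absurd (hiff.1 h) (by decide)
      have hevc : Even (cc D {x, y}) := by
        rcases hkf_cases D {x, y} with ⟨-, hor, -⟩ | ⟨hk, -, -⟩ | ⟨-, hiff⟩
        · rw [hr0] at hor; exact absurd hor (by decide)
        · exact absurd hk hk₂
        · rw [hr0] at hiff; exact Nat.not_odd_iff_even.1 fun h => absurd (hiff.2 h) (by decide)
      exact hevr.add hevc
  · rintro ⟨ℓ₁, -, hC₁, hfx₁, hk₁⟩ hno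
    rw [hC₁] at hk₁ hfx₁
    rcases hkf_cases {x, y} D with ⟨hk, -, -⟩ | ⟨-, -, her⟩ | ⟨hk, hiff⟩
    · exact absurd hk hk₁
    · exact Nat.not_odd_iff_even.1 her
    · refine Nat.not_odd_iff_even.1 fun hodd => ?_
      have hoc := hiff.1 hodd
      have hD : D.card = 2 := by by_contra hD; rw [hcc_zero _ _ hD] at hoc; exact absurd hoc (by decide)
      obtain ⟨hr, hc⟩ := hswap_counts {x, y} D hK₀2 hD
      obtain ⟨ℓ₂, hℓ₂, hR₂, -⟩ := hmemκ D (by rw [hc]; exact hoc.pos)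
      refine hno ⟨ℓ₂, hℓ₂, hR₂, ?_, ?_⟩
      · rw [hR₂]; exact hfx₁
      · rw [hR₂]
        rcases hkf_cases D {x, y} with ⟨-, -, hec'⟩ | ⟨-, -, her'⟩ | ⟨hk', -⟩
        · rw [hc] at hec'; exact absurd hoc hec'
        · rw [hr] at her'; exact absurd hodd her'
        · rw [hk', Finset.union_comm]; rw [hk] at hk₁; exact hk₁
  · rintro hno ⟨ℓ₂, -, hR₂, hfx₂, hk₂⟩
    rw [hR₂] at hk₂ hfx₂
    rcases hkf_cases D {x, y} with ⟨-, -, hec⟩ | ⟨hk, -, -⟩ | ⟨hk, hiff⟩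
    · exact Nat.not_odd_iff_even.1 hec
    · exact absurd hk hk₂
    · refine Nat.not_odd_iff_even.1 fun hodd => ?_
      have hor := hiff.2 hodd
      have hD : D.card = 2 := by by_contra hD; rw [hrc_zero _ _ hD] at hor; exact absurd hor (by decide)
      obtain ⟨hr, hc⟩ := hswap_counts {x, y} D hK₀2 hD
      obtain ⟨ℓ₁, hℓ₁, -, hC₁⟩ := hmemρ D (by rw [← hr]; exact hor.pos)
      refine hno ⟨ℓ₁, hℓ₁, hC₁, ?_, ?_⟩
      · rw [hC₁]; exact hfx₂
      · rw [hC₁]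
        rcases hkf_cases {x, y} D with ⟨-, -, hec'⟩ | ⟨-, -, her'⟩ | ⟨hk', -⟩
        · rw [← hc] at hec'; exact absurd hodd hec'
        · rw [← hr] at her'; exact absurd hor her'
        · rw [hk', Finset.union_comm]; rw [hk] at hk₂; exact hk₂

end MatrixAffine

end Summit.ValiantsHypothesis.ValiantsHypothesis.Theorems

end
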